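/-
Copyright (c) 2026 the pub-hodgecm-mathlib formalisation cell (harness21).  Prover seat hodgecm-mathlib-K2E3-p34 (g3), Track B «K2-LIT», engine E3, unit U4 «Keys»; PART
«U4Keys» socket :182 (U4f-χ₁-ram-one-pos), WILD CORNER (S-W) of the ED. 10 design (dealer K2E3-plan (g6) ROUND 5 deal (2); census `K2/K2E3-p34/g3/CENSUS-182-wild.md` offer (O1)):
the two-depth character identity of ★ p862449 `K2E3ConcaveLevelIwahoriCharacter` with the INTEGRALITY letter `|t| ≤ 1` of the trace-one element replaced by its MINIMALITY
(`∀ a, a + σa = 1 → |t| ≤ |a|`) and the two `t`-sensitive concavity inequalities carried with their `|t|`-weight.  KERNEL module: THEOREMS ONLY (no definition, no named fact,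
no `sorry`, no instance, no notation); MODEL level (`U(σ, Φ₃)(K)`, `Valued K ℤᵐ⁰`, an isometric involution `σ`, a uniformiser `ϖ`).  NOT THE PAYER of :182.
-/
import Summits.HodgeConjecture.HodgeConjecture.Theorems.K2E3ConcaveLevelIwahoriCharacter   -- ★ p862449 (K2E3-p34 g2): `sigma_add_mul_eq_neg`, `one_add_mul_add_mul_eq`, `v_pow_le_pow_of_le`, `v_mul_le_pow_add`, §2 pivots ∕ relations, §3 over `(e, Jg, hJg)`
import HarnessLib

/-!
# K2 ∕ E3 «EllipticInputs», unit U4 «Keys» — (U4f-χ₁-ram-one-pos), wild corner: THE TWO-DEPTH CHARACTER IDENTITY WITH A MINIMAL (POSSIBLY NON-INTEGRAL) TRACE-ONE ELEMENT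
# «`χ₁(1 + ỹx̃ + b̃z̃) = 1` from `|t|·|y|² ≤ |b|`, `|t|·|x|² ≤ |z|` and the `|t|`-weighted concavity inequalities»   [Tits1979 §1.15; BruhatTits1972 (6.4.9); Roche1998 §3; Serre1979 III §3]

Cell hodgecm-mathlib, Track B «K2-LIT», crux item H413 = `stmt-HodgeConjecture-24833` (route `HCCMUnconditional`, no route verbs); target BY NAME the OPEN tier-0 leaf
`…K2E3EllipticInputs.U4Keys.sig_K2E3KeysThmTwoContractingRamifiedCharOnePosDepth` (U4Keys :182), its WILD corner (`v ∣ 2` ramified in `L`: no INTEGRAL trace-one element,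
★ p862457 `K2E3LocalTraceOneLetter.valued_two_eq_one_of_ramified_of_traceOne`, ★ p862501 `K2E3LevelNWildCellNoWitness`).  Author K2E3-p34 (g3).  `--supports stmt-HodgeConjecture-24833
--as helper`; THEOREMS ONLY; hypothesis-first over ★ p862449's letters.  NOT THE PAYER of :182 — a place-uniform variant of the `hθmul` letter's model theorem; the wild corner
stays OPEN (census (d): «XL residual»).

THE POINT.  ★ p862449 §1 proves `χ₁(1 + yx + bz) = 1` (row relation `b + σb + yσy = 0`, column relation `z + σz + xσx = 0`, entry depths `r, s, r′, s′`, cond_E `≤ n`, cond_F `≤ c`)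
by splitting `b = β − t·yσy`, `z = ζ − t·xσx` with `β, ζ` `σ`-ANTI-invariant along a trace-one `t` — and it uses `|t| ≤ 1` three times (`|β| ≤ |ϖ|^{min(s,2r)}`; the correction terms
`tβ·xσx`, `tζ·yσy`, `t²·yσy·xσx`).  At a wildly ramified dyadic place NO integral `t` exists (`Tr 𝒪_E ⊆ 𝔭_F`); the trace-one elements have `ord_E ≤ 1 − d` (`d ≥ 2` the different exponent)
and the bound is attained [Serre1979 III §3].  This file replaces `|t| ≤ 1` by MINIMALITY, `htmin : ∀ a, a + σa = 1 → |t| ≤ |a|` — at a tame or unramified place every integral trace-one `t`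
is minimal (§1 `traceMin_of_v_le_one`: a trace-one element never has `|a| < 1`), so nothing is lost — and observes (§1 `v_mul_norm_le_of_traceMin`) that minimality gives, for free,
  `b + σb + yσy = 0 ⟹ |t|·|yσy| ≤ |b|`      (`−b∕(yσy)` has trace one),
the Bruhat–Tits bound of the wild quasi-split `SU₃` [Tits1979 §1.15] («`u(y,b) ∈ U_a ⟹ ord b ≤ 2·ord y + ord t_max`»).  Consequently `|β| ≤ |b| ≤ |ϖ|^s`, `|ζ| ≤ |z| ≤ |ϖ|^{s′}` with NO
integrality, `βζ` is `σ`-fixed in `𝔭^{s+s′} ⊆ 𝔭^c`, `|yx| ≤ |ϖ|^{r+r′} ≤ |ϖ|ⁿ`, and the three `t`-terms are bounded by `|t|·|ϖ|^{s+2r′}` and `|t|·|ϖ|^{s′+2r}` — so the identity holds under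
the `|t|`-WEIGHTED concavity inequalities `|t|·|ϖ|^{s+2r′} ≤ |ϖ|ⁿ`, `|t|·|ϖ|^{s′+2r} ≤ |ϖ|ⁿ` (§2), which at `|t| ≤ 1` are ★'s `n ≤ s + 2r′`, `n ≤ 2r + s′` (§2 `…_of_v_le_one`, recovering ★ :140's
shape) and at a wild place with `|t| = |ϖ|^{−δ}` read `s + 2r′ ≥ n + δ`, `s′ + 2r ≥ n + δ` (census (a): the threshold «cond_F reaches the different»; below it the identity is FALSE on Roche's
group — census (a) (iii), `E = ℚ₂(√2)`).  §3 lifts §2 to the pivots of `U(σ, Φ₃)` and §4 to ★ D174's letters `(e, Jg, hJg)` exactly as ★ p862449 §2–§3.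
* §1 `traceMin_of_v_le_one`, **`v_mul_norm_le_of_traceMin`**, `v_add_mul_le_of_traceMin` (`|β| ≤ |b|`).
* §2 **`chi_mk0_one_add_eq_one_of_traceMin`** (field level) + `chi_mk0_one_add_eq_one_of_traceMin_of_v_le_one` (the ★ letters imply the weighted ones).
* §3 `chi_mul_apply_zero_zero_of_traceMin` (entry bounds on `U(σ, Φ₃)`); §4 **`chi_apply_zero_zero_mul_of_concave_min`** (over `(e, Jg, hJg)`: the `hθmul` letter, minimal-`t` form).
HONEST LABEL: HC_CM is proved only modulo the 7 printed citations (2 remaining named inputs: hLiu418 = stmt-HodgeConjecture-24832, h413 = stmt-HodgeConjecture-24833)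
until rung 0 closes; count-neutral — this file pays no socket and closes nothing; no printed citation is discharged.

## References
* [Tits1979] J. Tits, *Reductive groups over local fields*, Proc. Sympos. Pure Math. 33.1 (1979), §1.15 (the ramified quasi-split `SU₃`, the trace constant).
* [BruhatTits1972] F. Bruhat, J. Tits, *Groupes réductifs sur un corps local I*, Publ. Math. IHÉS 41 (1972), (4.4.4), (6.4.9).
* [Roche1998] A. Roche, *Types and Hecke algebras for principal series representations of split reductive p-adic groups*, Ann. Sci. ÉNS (4) 31 (1998), §3.
* [Serre1979] J.-P. Serre, *Local Fields*, GTM 67 (1979), Ch. III §3 Prop. 7 (`Tr(𝔭_E^k) = 𝔭_F^{⌊(k+d)∕e⌋}`).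
* [MoyPrasad1996] A. Moy, G. Prasad, *Jacquet functors and unrefined minimal K-types*, Comment. Math. Helv. 71 (1996), §3.
-/

set_option autoImplicit false
-- the mandated namespace repeats the single-problem summit's segment (`HodgeConjecture.HodgeConjecture`)
set_option linter.dupNamespace false

noncomputable section

open Matrix Literature.NumberTheory.Automorphic Literature.NumberTheory.Automorphic.UnitaryGroup
open scoped Matrix MatrixGroups WithZero

namespace Summit.HodgeConjecture.HodgeConjecture.Cruxes.H413.K2E3ConcaveLevelIwahoriCharacterMin

open Summit.HodgeConjecture.HodgeConjecture.Cruxes.H413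
open Summit.HodgeConjecture.HodgeConjecture.Cruxes.H413.K2E3ConcaveLevelIwahoriCharacter

/-! ## §1 Minimal trace-one elements -/

section TraceMin

variable {K : Type*} [Field K] [Valued K ℤᵐ⁰] (σ : K →+* K) {ϖ : K}
  (hσ : ∀ a, σ (σ a) = a) (hvσ : ∀ a, Valued.v (σ a) = Valued.v a) (hvϖ : Valued.v ϖ = WithZero.exp (-1 : ℤ))

include hvσ in
/-- **A trace-one element is never topologically nilpotent**: `a + σa = 1 ⟹ 1 ≤ |a|` (else `|a + σa| ≤ max(|a|, |σa|) < 1 = |1|`).  Hence an INTEGRAL trace-one `t` (`|t| ≤ 1`) is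
MINIMAL: `|t| ≤ |a|` for every trace-one `a` — the tame∕unramified case of the letter `htmin`. [cite: Serre1979, Ch. III §3 Prop. 7] -/
theorem traceMin_of_v_le_one {t : K} (hvt : Valued.v t ≤ 1) : ∀ a : K, a + σ a = 1 → Valued.v t ≤ Valued.v a := by
  intro a ha
  refine hvt.trans (not_lt.1 fun hlt => ?_)
  have h1 : Valued.v (a + σ a) < 1 := lt_of_le_of_lt (Valued.v.map_add_le le_rfl (by rw [hvσ])) hlt
  rw [ha, Valuation.map_one] at h1
  exact lt_irrefl _ h1

include hσ in
/-- **THE BRUHAT–TITS BOUND FROM MINIMALITY.**  If `t` is a MINIMAL trace-one element (`|t| ≤ |a|` whenever `a + σa = 1`) and `b + σb + yσy = 0`, then **`|t·yσy| ≤ |b|`**: for `y ≠ 0`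
the element `−b∕(yσy)` has trace one (`yσy` is `σ`-fixed).  This is «`u(y,b) ∈ U_a ⟹ ord b ≤ 2·ord y + ord t_max`» for the ramified quasi-split `SU₃`; at a wild place it FORCES
`|b| ≥ |y|²|ϖ|^{−δ}`. [cite: Tits1979, §1.15] [cite: BruhatTits1972, (6.4.9)] -/
theorem v_mul_norm_le_of_traceMin {t : K} (htmin : ∀ a : K, a + σ a = 1 → Valued.v t ≤ Valued.v a)
    {y b : K} (hb : b + σ b + y * σ y = 0) : Valued.v (t * (y * σ y)) ≤ Valued.v b := by
  by_cases hy : y = 0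
  · simp [hy]
  have hσy : σ y ≠ 0 := (map_ne_zero σ).2 hy
  have hN0 : y * σ y ≠ 0 := mul_ne_zero hy hσy
  have hvN0 : Valued.v (y * σ y) ≠ 0 := (Valuation.ne_zero_iff _).2 hN0
  have hσN : σ (y * σ y) = y * σ y := by rw [map_mul, hσ, mul_comm]
  have ha : -b / (y * σ y) + σ (-b / (y * σ y)) = 1 := by
    rw [map_div₀, map_neg, hσN, ← add_div, div_eq_one_iff_eq hN0]
    linear_combination (-1 : K) * hb
  have h := htmin _ ha
  rw [map_div₀, Valuation.map_neg] at h
  have h' := mul_le_mul' h (le_refl (Valued.v (y * σ y)))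
  rw [div_mul_cancel₀ _ hvN0] at h'
  rwa [map_mul]

include hσ in
/-- **`|β| ≤ |b|` for `β := b + t·yσy`** under minimality of `t` and the row relation (no integrality of `t`). [cite: Tits1979, §1.15] [cite: Roche1998, §3] -/
theorem v_add_mul_le_of_traceMin {t : K} (htmin : ∀ a : K, a + σ a = 1 → Valued.v t ≤ Valued.v a)
    {y b : K} (hb : b + σ b + y * σ y = 0) : Valued.v (b + t * (y * σ y)) ≤ Valued.v b :=
  Valued.v.map_add_le le_rfl (v_mul_norm_le_of_traceMin σ hσ htmin hb)

end TraceMin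

/-! ## §2 Field level: `χ₁(1 + yx + bz) = 1` with a minimal trace-one element -/

section FieldLevel

variable {K : Type*} [Field K] [Valued K ℤᵐ⁰] (σ : K →+* K) {ϖ : K}
  (hσ : ∀ a, σ (σ a) = a) (hvσ : ∀ a, Valued.v (σ a) = Valued.v a) (hvϖ : Valued.v ϖ = WithZero.exp (-1 : ℤ))

include hσ hvσ hvϖ in
/-- **`χ₁(1 + yx + bz) = 1` — THE TWO-DEPTH CHARACTER IDENTITY WITH A MINIMAL TRACE-ONE ELEMENT.**  Let `χ₁ : Kˣ → ℂˣ` be trivial on `{u : |u − 1| ≤ |ϖ|ⁿ}` and on the `σ`-fixed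
`{u : σu = u, |u − 1| ≤ |ϖ|^c}` (`1 ≤ c`); let `t + σt = 1` be MINIMAL (`|t| ≤ |a|` for every trace-one `a`; `|t| > 1` allowed); let `b + σb + yσy = 0`, `z + σz + xσx = 0` with
`|y| ≤ |ϖ|^r`, `|b| ≤ |ϖ|^s`, `|x| ≤ |ϖ|^{r′}`, `|z| ≤ |ϖ|^{s′}`; and assume `n ≤ r + r′`, `c ≤ s + s′` and the `|t|`-WEIGHTED concavity inequalities `|t|·|ϖ|^{s+2r′} ≤ |ϖ|ⁿ`,
`|t|·|ϖ|^{s′+2r} ≤ |ϖ|ⁿ`.  Then `χ₁(1 + yx + bz) = 1`: `1 + yx + bz = (1 + βζ)·u`, `β = b + t·yσy`, `ζ = z + t·xσx` anti-invariant with `|β| ≤ |b|`, `|ζ| ≤ |z|` (§1), `|u − 1| ≤ |ϖ|ⁿ`.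
[cite: Roche1998, §3] [cite: Tits1979, §1.15] [cite: BruhatTits1972, (6.4.9)] [cite: MoyPrasad1996, §3] -/
theorem chi_mk0_one_add_eq_one_of_traceMin (χ₁ : Kˣ →* ℂˣ) {n c : ℕ} (hc1 : 1 ≤ c)
    (hcond : ∀ u : Kˣ, Valued.v ((u : K) - 1) ≤ Valued.v ϖ ^ n → χ₁ u = 1)
    (hcondF : ∀ u : Kˣ, σ (u : K) = u → Valued.v ((u : K) - 1) ≤ Valued.v ϖ ^ c → χ₁ u = 1)
    {t : K} (ht : t + σ t = 1) (htmin : ∀ a : K, a + σ a = 1 → Valued.v t ≤ Valued.v a)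
    {y b x z : K} (hb : b + σ b + y * σ y = 0) (hz : z + σ z + x * σ x = 0)
    {r s r' s' : ℕ} (hy : Valued.v y ≤ Valued.v ϖ ^ r) (hvb : Valued.v b ≤ Valued.v ϖ ^ s)
    (hx : Valued.v x ≤ Valued.v ϖ ^ r') (hvz : Valued.v z ≤ Valued.v ϖ ^ s')
    (h1 : n ≤ r + r') (hT2 : Valued.v t * Valued.v ϖ ^ (s + 2 * r') ≤ Valued.v ϖ ^ n)
    (hT3 : Valued.v t * Valued.v ϖ ^ (s' + 2 * r) ≤ Valued.v ϖ ^ n) (h4 : c ≤ s + s')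
    (h0 : 1 + y * x + b * z ≠ 0) :
    χ₁ (Units.mk0 (1 + y * x + b * z) h0) = 1 := by
  have hvϖ1 : Valued.v ϖ < 1 := by rw [hvϖ, ← WithZero.exp_zero, WithZero.exp_lt_exp]; norm_num
  have hvϖc : Valued.v ϖ ^ c < 1 := pow_lt_one' hvϖ1 (Nat.one_le_iff_ne_zero.1 hc1)
  -- minimality: `|t·yσy| ≤ |b|`, `|t·xσx| ≤ |z|`; hence `|β| ≤ |ϖ|^s`, `|ζ| ≤ |ϖ|^{s′}`
  have htN : Valued.v (t * (y * σ y)) ≤ Valued.v b := v_mul_norm_le_of_traceMin σ hσ htmin hb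
  have hvβ : Valued.v (b + t * (y * σ y)) ≤ Valued.v ϖ ^ s := (v_add_mul_le_of_traceMin σ hσ htmin hb).trans hvb
  have hvζ : Valued.v (z + t * (x * σ x)) ≤ Valued.v ϖ ^ s' := (v_add_mul_le_of_traceMin σ hσ htmin hz).trans hvz
  have hσβ : σ (b + t * (y * σ y)) = -(b + t * (y * σ y)) := sigma_add_mul_eq_neg σ hσ ht hb
  have hσζ : σ (z + t * (x * σ x)) = -(z + t * (x * σ x)) := sigma_add_mul_eq_neg σ hσ ht hz
  -- the `σ`-fixed factor `1 + βζ`, `|βζ| ≤ |ϖ|^{s+s′} ≤ |ϖ|^c`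
  have hvβζ : Valued.v ((b + t * (y * σ y)) * (z + t * (x * σ x))) ≤ Valued.v ϖ ^ c :=
    (v_mul_le_pow_add hvβ hvζ).trans (v_pow_le_pow_of_le hvϖ h4)
  have hvF : Valued.v (1 + (b + t * (y * σ y)) * (z + t * (x * σ x))) = 1 := Valued.v.map_one_add_of_lt (hvβζ.trans_lt hvϖc)
  have hF0 : 1 + (b + t * (y * σ y)) * (z + t * (x * σ x)) ≠ 0 := fun h => by rw [h, map_zero] at hvF; exact zero_ne_one hvF
  have hχF : χ₁ (Units.mk0 _ hF0) = 1 := by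
    refine hcondF _ ?_ ?_
    · rw [Units.val_mk0, map_add, map_one, map_mul, hσβ, hσζ, neg_mul_neg]
    · rw [Units.val_mk0, add_sub_cancel_left]; exact hvβζ
  -- the four correction terms lie in `𝔭ⁿ`
  have hxx : Valued.v (x * σ x) ≤ Valued.v ϖ ^ (2 * r') := by rw [two_mul]; exact v_mul_le_pow_add hx (by rwa [hvσ])
  have hyy : Valued.v (y * σ y) ≤ Valued.v ϖ ^ (2 * r) := by rw [two_mul]; exact v_mul_le_pow_add hy (by rwa [hvσ])
  have hE1 : Valued.v (y * x) ≤ Valued.v ϖ ^ n := (v_mul_le_pow_add hy hx).trans (v_pow_le_pow_of_le hvϖ h1)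
  have hE2 : Valued.v (t * (b + t * (y * σ y)) * (x * σ x)) ≤ Valued.v ϖ ^ n := by
    rw [map_mul, map_mul]
    calc Valued.v t * Valued.v (b + t * (y * σ y)) * Valued.v (x * σ x)
          ≤ Valued.v t * Valued.v ϖ ^ s * Valued.v ϖ ^ (2 * r') := mul_le_mul' (mul_le_mul' le_rfl hvβ) hxx
      _ = Valued.v t * Valued.v ϖ ^ (s + 2 * r') := by rw [pow_add, mul_assoc]
      _ ≤ Valued.v ϖ ^ n := hT2
  have hE3 : Valued.v (t * (z + t * (x * σ x)) * (y * σ y)) ≤ Valued.v ϖ ^ n := by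
    rw [map_mul, map_mul]
    calc Valued.v t * Valued.v (z + t * (x * σ x)) * Valued.v (y * σ y)
          ≤ Valued.v t * Valued.v ϖ ^ s' * Valued.v ϖ ^ (2 * r) := mul_le_mul' (mul_le_mul' le_rfl hvζ) hyy
      _ = Valued.v t * Valued.v ϖ ^ (s' + 2 * r) := by rw [pow_add, mul_assoc]
      _ ≤ Valued.v ϖ ^ n := hT3
  have hE4 : Valued.v (t * t * (y * σ y) * (x * σ x)) ≤ Valued.v ϖ ^ n := by
    rw [show t * t * (y * σ y) * (x * σ x) = (t * (y * σ y)) * (t * (x * σ x)) by ring, map_mul Valued.v (t * (y * σ y)) (t * (x * σ x)),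
      map_mul Valued.v t (x * σ x)]
    calc Valued.v (t * (y * σ y)) * (Valued.v t * Valued.v (x * σ x))
          ≤ Valued.v ϖ ^ s * (Valued.v t * Valued.v ϖ ^ (2 * r')) := mul_le_mul' (htN.trans hvb) (mul_le_mul' le_rfl hxx)
      _ = Valued.v t * Valued.v ϖ ^ (s + 2 * r') := by rw [pow_add]; simp only [mul_comm, mul_left_comm]
      _ ≤ Valued.v ϖ ^ n := hT2
  have hE : Valued.v (y * x - t * (b + t * (y * σ y)) * (x * σ x) - t * (z + t * (x * σ x)) * (y * σ y) + t * t * (y * σ y) * (x * σ x)) ≤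
      Valued.v ϖ ^ n :=
    Valued.v.map_add_le (Valued.v.map_sub_le (Valued.v.map_sub_le hE1 hE2) hE3) hE4
  -- the correction `u = (1 + yx + bz) ∕ (1 + βζ)` is `≡ 1 (mod 𝔭ⁿ)`
  have hdecomp := one_add_mul_add_mul_eq σ t y b x z
  have hu : Valued.v (((Units.mk0 (1 + y * x + b * z) h0 * (Units.mk0 _ hF0)⁻¹ : Kˣ) : K) - 1) ≤ Valued.v ϖ ^ n := by
    have hval : ((Units.mk0 (1 + y * x + b * z) h0 * (Units.mk0 _ hF0)⁻¹ : Kˣ) : K) =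
        (1 + y * x + b * z) * (1 + (b + t * (y * σ y)) * (z + t * (x * σ x)))⁻¹ := by
      simp only [Units.val_mul, Units.val_inv_eq_inv_val, Units.val_mk0]
    rw [hval, show (1 + y * x + b * z) * (1 + (b + t * (y * σ y)) * (z + t * (x * σ x)))⁻¹ - 1 =
        ((1 + y * x + b * z) - (1 + (b + t * (y * σ y)) * (z + t * (x * σ x)))) * (1 + (b + t * (y * σ y)) * (z + t * (x * σ x)))⁻¹ from by
        rw [sub_mul, mul_inv_cancel₀ hF0],
      map_mul, map_inv₀, hvF, inv_one, mul_one, hdecomp, add_sub_cancel_left]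
    exact hE
  have h1' := hcond _ hu
  rw [map_mul, map_inv, hχF, inv_one, mul_one] at h1'
  exact h1'

/-- At `|t| ≤ 1` the weighted inequality follows from the plain one: `n ≤ k ⟹ |t|·|ϖ|ᵏ ≤ |ϖ|ⁿ`. [cite: BruhatTits1972, (6.4.9)] -/
theorem v_mul_pow_le_pow_of_v_le_one (hvϖ : Valued.v ϖ = WithZero.exp (-1 : ℤ)) {t : K} (hvt : Valued.v t ≤ 1) {n k : ℕ} (h : n ≤ k) :
    Valued.v t * Valued.v ϖ ^ k ≤ Valued.v ϖ ^ n :=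
  ((mul_le_mul' hvt le_rfl).trans_eq (one_mul _)).trans (v_pow_le_pow_of_le hvϖ h)

include hσ hvσ hvϖ in
/-- **The ★ p862449 shape is an instance**: with an INTEGRAL trace-one `t` (`|t| ≤ 1`, hence minimal by §1) and the plain concavity inequalities `n ≤ 2r + s′`, `n ≤ s + 2r′`, the
hypotheses of `chi_mk0_one_add_eq_one_of_traceMin` hold; so this file's identity specialises to (the statement of) ★ `chi_mk0_one_add_eq_one_of_traceOne`. [cite: Roche1998, §3] -/
theorem chi_mk0_one_add_eq_one_of_traceMin_of_v_le_one (χ₁ : Kˣ →* ℂˣ) {n c : ℕ} (hc1 : 1 ≤ c)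
    (hcond : ∀ u : Kˣ, Valued.v ((u : K) - 1) ≤ Valued.v ϖ ^ n → χ₁ u = 1)
    (hcondF : ∀ u : Kˣ, σ (u : K) = u → Valued.v ((u : K) - 1) ≤ Valued.v ϖ ^ c → χ₁ u = 1)
    {t : K} (ht : t + σ t = 1) (hvt : Valued.v t ≤ 1)
    {y b x z : K} (hb : b + σ b + y * σ y = 0) (hz : z + σ z + x * σ x = 0)
    {r s r' s' : ℕ} (hy : Valued.v y ≤ Valued.v ϖ ^ r) (hvb : Valued.v b ≤ Valued.v ϖ ^ s)
    (hx : Valued.v x ≤ Valued.v ϖ ^ r') (hvz : Valued.v z ≤ Valued.v ϖ ^ s')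
    (h1 : n ≤ r + r') (h2 : n ≤ 2 * r + s') (h3 : n ≤ s + 2 * r') (h4 : c ≤ s + s')
    (h0 : 1 + y * x + b * z ≠ 0) :
    χ₁ (Units.mk0 (1 + y * x + b * z) h0) = 1 :=
  chi_mk0_one_add_eq_one_of_traceMin σ hσ hvσ hvϖ χ₁ hc1 hcond hcondF ht (traceMin_of_v_le_one σ hvσ hvt) hb hz hy hvb hx hvz h1
    (v_mul_pow_le_pow_of_v_le_one hvϖ hvt h3) (v_mul_pow_le_pow_of_v_le_one hvϖ hvt (by omega)) h4 h0

end FieldLevel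

/-! ## §3 Matrix level on `U(σ, Φ₃)`: entry bounds and the pivots -/

section MatrixLevel

variable {K : Type*} [Field K] [Valued K ℤᵐ⁰]
  (σ : K →+* K) {ϖ : K} {J : Matrix (Fin 3) (Fin 3) K} (hJ : J = (StdForm.antidiagonal 3).over K)
  (hσ : ∀ a, σ (σ a) = a) (hvσ : ∀ a, Valued.v (σ a) = Valued.v a) (hvϖ : Valued.v ϖ = WithZero.exp (-1 : ℤ))

include hJ hσ hvσ hvϖ in
/-- **`χ₁((jj′)₀₀) = χ₁(j₀₀)·χ₁(j′₀₀)` ON ENTRY BOUNDS, minimal-`t` form.**  As ★ `chi_mul_apply_zero_zero_of_traceOne` (unit pivots, row-`0` depths `r, s` of `j`, column-`0` depths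
`r′, s′` of `j′`, cond_E `≤ n`, cond_F `≤ c`, `1 ≤ c`, `n ≤ r + r′`, `c ≤ s + s′`) with `|t| ≤ 1`, `n ≤ 2r + s′`, `n ≤ s + 2r′` replaced by MINIMALITY of `t` and the `|t|`-weighted
inequalities `|t|·|ϖ|^{s+2r′} ≤ |ϖ|ⁿ`, `|t|·|ϖ|^{s′+2r} ≤ |ϖ|ⁿ` (★ §2 `(jj′)₀₀ = j₀₀j′₀₀(1 + ỹx̃ + b̃z̃)` + ★ isotropy relations + §2).
[cite: Roche1998, §3] [cite: Tits1979, §1.15] [cite: BruhatTits1972, (4.4.4), (6.4.9)] -/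
theorem chi_mul_apply_zero_zero_of_traceMin (χ₁ : Kˣ →* ℂˣ) {n c : ℕ} (hc1 : 1 ≤ c)
    (hcond : ∀ u : Kˣ, Valued.v ((u : K) - 1) ≤ Valued.v ϖ ^ n → χ₁ u = 1)
    (hcondF : ∀ u : Kˣ, σ (u : K) = u → Valued.v ((u : K) - 1) ≤ Valued.v ϖ ^ c → χ₁ u = 1)
    {t : K} (ht : t + σ t = 1) (htmin : ∀ a : K, a + σ a = 1 → Valued.v t ≤ Valued.v a)
    {j j' : ↥(unitaryGroupOfForm σ J)} (hj : Valued.v (((j : GL (Fin 3) K) : Matrix (Fin 3) (Fin 3) K) 0 0) = 1)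
    (hj' : Valued.v (((j' : GL (Fin 3) K) : Matrix (Fin 3) (Fin 3) K) 0 0) = 1)
    {r s r' s' : ℕ} (hy : Valued.v (((j : GL (Fin 3) K) : Matrix (Fin 3) (Fin 3) K) 0 1) ≤ Valued.v ϖ ^ r)
    (hb : Valued.v (((j : GL (Fin 3) K) : Matrix (Fin 3) (Fin 3) K) 0 2) ≤ Valued.v ϖ ^ s)
    (hx : Valued.v (((j' : GL (Fin 3) K) : Matrix (Fin 3) (Fin 3) K) 1 0) ≤ Valued.v ϖ ^ r')
    (hz : Valued.v (((j' : GL (Fin 3) K) : Matrix (Fin 3) (Fin 3) K) 2 0) ≤ Valued.v ϖ ^ s')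
    (h1 : n ≤ r + r') (hT2 : Valued.v t * Valued.v ϖ ^ (s + 2 * r') ≤ Valued.v ϖ ^ n)
    (hT3 : Valued.v t * Valued.v ϖ ^ (s' + 2 * r) ≤ Valued.v ϖ ^ n) (h4 : c ≤ s + s')
    (h0 : (((j * j' : ↥(unitaryGroupOfForm σ J)) : GL (Fin 3) K) : Matrix (Fin 3) (Fin 3) K) 0 0 ≠ 0)
    (h10 : (((j : GL (Fin 3) K) : Matrix (Fin 3) (Fin 3) K) 0 0) ≠ 0) (h20 : (((j' : GL (Fin 3) K) : Matrix (Fin 3) (Fin 3) K) 0 0) ≠ 0) :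
    χ₁ (Units.mk0 _ h0) = χ₁ (Units.mk0 _ h10) * χ₁ (Units.mk0 _ h20) := by
  obtain ⟨hw0, hunits⟩ := mk0_mul_apply_zero_zero_eq σ j j' h0 h10 h20
  rw [hunits, map_mul, map_mul, chi_mk0_one_add_eq_one_of_traceMin σ hσ hvσ hvϖ χ₁ hc1 hcond hcondF ht htmin
    (row_zero_rel σ hJ hσ j h10) (col_zero_rel σ hJ j' h20) (by rw [map_div₀, hj, div_one]; exact hy) (by rw [map_div₀, hj, div_one]; exact hb)
    (by rw [map_div₀, hj', div_one]; exact hx) (by rw [map_div₀, hj', div_one]; exact hz) h1 hT2 hT3 h4 hw0, mul_one]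

end MatrixLevel

/-! ## §4 Over D174's letters `(e, Jg, hJg)`: the `hθmul` letter, minimal-`t` form -/

section ConcaveLevel

variable {K : Type*} [Field K] [Valued K ℤᵐ⁰] [ValuativeRel K] [(Valued.v : Valuation K ℤᵐ⁰).Compatible]
  (σ : K →+* K) {ϖ : K} {J : Matrix (Fin 3) (Fin 3) K} (hJ : J = (StdForm.antidiagonal 3).over K)
  (hσ : ∀ a, σ (σ a) = a) (hvσ : ∀ a, Valued.v (σ a) = Valued.v a) (hvϖ : Valued.v ϖ = WithZero.exp (-1 : ℤ))
  (e : Fin 3 → Fin 3 → ℕ) (Jg : Subgroup ↥(unitaryGroupOfForm σ J))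
  (hJg : ∀ k : ↥(unitaryGroupOfForm σ J), k ∈ Jg ↔ ∀ i j, Valued.v (((k : GL (Fin 3) K) : Matrix (Fin 3) (Fin 3) K) i j) ≤ Valued.v ϖ ^ e i j)

include hJ hσ hvσ hvϖ hJg in
/-- **`θ(j) := χ₁(j₀₀)` IS MULTIPLICATIVE ON THE TWO-DEPTH GROUP `Jg` — MINIMAL-`t` FORM of the (v)-θ^{<} letter ★ `chi_apply_zero_zero_mul_of_concave`.**  Exponent matrix `e` with
`1 ≤ e 1 0`, `1 ≤ e 2 0`; `χ₁` trivial on `{u : |u − 1| ≤ |ϖ|ⁿ}` and on the `σ`-fixed `{u : σu = u, |u − 1| ≤ |ϖ|^c}` (`1 ≤ c`); a MINIMAL trace-one `t`; `n ≤ e 0 1 + e 1 0`,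
`c ≤ e 0 2 + e 2 0`, and the `|t|`-weighted inequalities `|t|·|ϖ|^{e 0 2 + 2·e 1 0} ≤ |ϖ|ⁿ`, `|t|·|ϖ|^{e 2 0 + 2·e 0 1} ≤ |ϖ|ⁿ`.  Then `χ₁((jj′)₀₀) = χ₁(j₀₀)·χ₁(j′₀₀)` for `j, j′ ∈ Jg`.  At an
integral `t` this is ★'s regime (§2 `…_of_v_le_one`); at a wild place (`|t| = |ϖ|^{−δ}`) it is Roche's `J_χ` carrying `χ̃` iff cond_F reaches the different (census (a)).
[cite: Roche1998, §3] [cite: Tits1979, §1.15] [cite: MoyPrasad1996, §3] [cite: BruhatTits1972, (6.4.9)] -/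
theorem chi_apply_zero_zero_mul_of_concave_min (h10e : 1 ≤ e 1 0) (h20e : 1 ≤ e 2 0) (χ₁ : Kˣ →* ℂˣ) {n c : ℕ} (hc1 : 1 ≤ c)
    (hcond : ∀ u : Kˣ, Valued.v ((u : K) - 1) ≤ Valued.v ϖ ^ n → χ₁ u = 1)
    (hcondF : ∀ u : Kˣ, σ (u : K) = u → Valued.v ((u : K) - 1) ≤ Valued.v ϖ ^ c → χ₁ u = 1)
    {t : K} (ht : t + σ t = 1) (htmin : ∀ a : K, a + σ a = 1 → Valued.v t ≤ Valued.v a)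
    (h1 : n ≤ e 0 1 + e 1 0) (hT2 : Valued.v t * Valued.v ϖ ^ (e 0 2 + 2 * e 1 0) ≤ Valued.v ϖ ^ n)
    (hT3 : Valued.v t * Valued.v ϖ ^ (e 2 0 + 2 * e 0 1) ≤ Valued.v ϖ ^ n) (h4 : c ≤ e 0 2 + e 2 0)
    {j j' : ↥(unitaryGroupOfForm σ J)} (hj : j ∈ Jg) (hj' : j' ∈ Jg)
    (h0 : (((j * j' : ↥(unitaryGroupOfForm σ J)) : GL (Fin 3) K) : Matrix (Fin 3) (Fin 3) K) 0 0 ≠ 0)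
    (h10 : (((j : GL (Fin 3) K) : Matrix (Fin 3) (Fin 3) K) 0 0) ≠ 0) (h20 : (((j' : GL (Fin 3) K) : Matrix (Fin 3) (Fin 3) K) 0 0) ≠ 0) :
    χ₁ (Units.mk0 _ h0) = χ₁ (Units.mk0 _ h10) * χ₁ (Units.mk0 _ h20) :=
  chi_mul_apply_zero_zero_of_traceMin σ hJ hσ hvσ hvϖ χ₁ hc1 hcond hcondF ht htmin
    (K2E3IwahoriTwoDepthFactorisation.v_apply_zero_zero_eq_one_of_mem σ hJ hvσ hvϖ e Jg hJg h10e h20e hj)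
    (K2E3IwahoriTwoDepthFactorisation.v_apply_zero_zero_eq_one_of_mem σ hJ hvσ hvϖ e Jg hJg h10e h20e hj')
    (((hJg j).1 hj) 0 1) (((hJg j).1 hj) 0 2) (((hJg j').1 hj') 1 0) (((hJg j').1 hj') 2 0) h1 hT2 hT3 h4 h0 h10 h20

end ConcaveLevel

end Summit.HodgeConjecture.HodgeConjecture.Cruxes.H413.K2E3ConcaveLevelIwahoriCharacterMin

end
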